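import Summits.QuantumFields.YangMills.Theorems.ColdStartUniversalityColdStartSolutionsExistCoordMartingale
import Literature.MathematicalPhysics.QuantumFieldTheory.LatticeLangevinDynamics
import HarnessLib

/-!
# Route `ColdStartUniversality`, support item S (stmt-QuantumFields-24811), line `piwiener`:
# Itô integrals against the coordinates of a FLAT Brownian motion, w.r.t. `IsFlatBrownian.natFiltration`

Helper file (lead `ym-line-csu-p1`) for the OPEN stubs A/B of `Cruxes/ColdStartSolutionsExist/Lines/piwiener.lean`,
which are stated with the filtration `hW.natFiltration` of `hW : IsFlatBrownian W P` (index set `Edge d L × κ`),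
whereas the landed integration bricks (p601258 `…CoordMartingale`) are stated for `IsBrownianVec` (index set
`Fin n`, after the enumeration `Fintype.equivFin`).  This file is the bridge:

* `natFiltration_flat_eq` — the two raw natural filtrations COINCIDE (the enumeration is a
  measurable equivalence of the index-function spaces, so `σ(W_s) = σ(W'_s)` for every `s`);
* `martingale_flatCoord`, `martingale_flatCoord_sq_sub`, `memLp_two_flatCoord`, `continuous_flatCoord` —
  each coordinate `t ↦ W t ω i`, `i : Edge d L × κ`, is an `L²` martingale with compensator `t` for
  `hW.natFiltration`;
* `exists_isItoIntegral_flatCoord` — every `hW.natFiltration`-progressive integrand with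
  `E ∫₀ᵗ H² ds < ∞` has an Itô integral `∫ H dW^i` (square-integrable martingale) w.r.t. `hW.natFiltration`;
* `lintegral_iSup_itoIntegral_flatCoord_sub_sq_le` — the Doob–Itô `L²` maximal inequality for
  two such integrals against the same coordinate.

No definition, no sorry, standard axioms.  RECORD-rung plumbing; nothing here bears on the mass gap.
-/

set_option autoImplicit false

noncomputable section

namespace Summit.QuantumFields.YangMills.Theorems.ColdStartUniversality

open MeasureTheory ProbabilityTheory Filter
open scoped NNReal ENNReal
open Literature.Probability.Process Literature.MathematicalPhysics.QuantumFieldTheory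

variable {Ω : Type*} {mΩ : MeasurableSpace Ω} {P : Measure Ω} {d L : ℕ} [NeZero L] {κ : Type*} [Fintype κ]
  {W : ℝ≥0 → Ω → (Edge d L × κ → ℝ)}

/-- The enumerated process behind `IsFlatBrownian`: `W' t ω k = W t ω (e⁻¹ k)`, `e = Fintype.equivFin _`.
Its coordinates are the coordinates of `W`: `W' t ω (e i) = W t ω i`. [folklore] -/
theorem flatCoord_eq (i : Edge d L × κ) :
    (fun t ω => (fun k => W t ω ((Fintype.equivFin (Edge d L × κ)).symm k)) (Fintype.equivFin (Edge d L × κ) i)) =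
      fun t ω => W t ω i := by
  funext t ω
  simp only [Equiv.symm_apply_apply]

/-- **The raw natural filtration of a flat Brownian motion is the raw natural filtration of its
enumeration** (`IsFlatBrownian.natFiltration hW = IsBrownianVec.natFiltration hW`): reindexing the coordinates
along `Fintype.equivFin` is a measurable equivalence, so it does not change `σ(W_s)`. [folklore] -/
theorem natFiltration_flat_eq (hW : IsFlatBrownian W P) :
    hW.natFiltration = IsBrownianVec.natFiltration (W := fun t ω k => W t ω ((Fintype.equivFin (Edge d L × κ)).symm k)) hW := by
  refine Filtration.ext ?_
  funext t
  change (⨆ j ≤ t, MeasurableSpace.comap (W j) inferInstance) =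
    ⨆ j ≤ t, MeasurableSpace.comap (fun ω k => W j ω ((Fintype.equivFin (Edge d L × κ)).symm k)) inferInstance
  refine iSup_congr fun j => iSup_congr fun _ => ?_
  -- the reindexing as a measurable equivalence
  let φ : (Edge d L × κ → ℝ) ≃ᵐ (Fin (Fintype.card (Edge d L × κ)) → ℝ) :=
    MeasurableEquiv.piCongrLeft (fun _ => ℝ) (Fintype.equivFin (Edge d L × κ))
  have hφ : (fun ω k => W j ω ((Fintype.equivFin (Edge d L × κ)).symm k)) = φ ∘ W j := by
    funext ω k
    simp only [Function.comp_apply, φ, MeasurableEquiv.coe_piCongrLeft, Equiv.piCongrLeft_apply,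
      eq_rec_constant]
  rw [hφ, ← MeasurableSpace.comap_comp, φ.measurableEmbedding.comap_eq]

/-- Each coordinate `t ↦ W t ω i` of a flat Brownian motion is a martingale for `hW.natFiltration`.
[folklore] -/
theorem martingale_flatCoord [IsProbabilityMeasure P] (hW : IsFlatBrownian W P) (i : Edge d L × κ) :
    Martingale (fun t ω => W t ω i) hW.natFiltration P := by
  rw [natFiltration_flat_eq hW, ← flatCoord_eq i]
  exact martingale_coord hW _

/-- `(W t ω i)² − t` is a martingale for `hW.natFiltration`. [folklore] -/
theorem martingale_flatCoord_sq_sub [IsProbabilityMeasure P] (hW : IsFlatBrownian W P)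
    (i : Edge d L × κ) : Martingale (fun t ω => (W t ω i) ^ 2 - (t : ℝ)) hW.natFiltration P := by
  rw [natFiltration_flat_eq hW]
  have h := martingale_coord_sq_sub hW (Fintype.equivFin (Edge d L × κ) i)
  simp only [Equiv.symm_apply_apply] at h
  exact h

/-- Each coordinate `W t ω i` is square integrable. [folklore] -/
theorem memLp_two_flatCoord [IsProbabilityMeasure P] (hW : IsFlatBrownian W P) (t : ℝ≥0)
    (i : Edge d L × κ) : MemLp (fun ω => W t ω i) 2 P := by
  have h := memLp_two_coord hW t (Fintype.equivFin (Edge d L × κ) i)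
  simp only [Equiv.symm_apply_apply] at h
  exact h

/-- Each coordinate path is continuous. [folklore] -/
theorem continuous_flatCoord (hW : IsFlatBrownian W P) (i : Edge d L × κ) (ω : Ω) :
    Continuous fun t => W t ω i := by
  have h := continuous_coord hW (Fintype.equivFin (Edge d L × κ) i) ω
  simp only [Equiv.symm_apply_apply] at h
  exact h

/-- **Itô integrals against a coordinate of a flat Brownian motion, w.r.t. `hW.natFiltration`**: every
progressive `H` with `E ∫₀ᵗ H² ds < ∞` for all `t` has `J = ∫ H dW^i` in the sense of the tree's `IsItoIntegral`,
and `J` is a square-integrable martingale. [folklore] -/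
theorem exists_isItoIntegral_flatCoord [IsProbabilityMeasure P] (hW : IsFlatBrownian W P)
    (i : Edge d L × κ) {H : ℝ≥0 → Ω → ℝ} (hH : IsStronglyProgressive hW.natFiltration H)
    (hfin : ∀ t : ℝ≥0, sqErr H 0 P t ≠ ⊤) :
    ∃ J : ℝ≥0 → Ω → ℝ, IsItoIntegral H (fun t ω => W t ω i) J hW.natFiltration P ∧
      Martingale J hW.natFiltration P ∧ ∀ t, MemLp (J t) 2 P := by
  obtain ⟨J, hJ, hJM, hJ2, -⟩ := exists_isItoIntegral_of_sqErr_ne_top (martingale_flatCoord hW i)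
    (martingale_flatCoord_sq_sub hW i) (fun t => memLp_two_flatCoord hW t i) (continuous_flatCoord hW i) hH hfin
  exact ⟨J, hJ, hJM, hJ2⟩

/-- **Doob–Itô `L²` maximal inequality** for two integrals against the same coordinate of a flat Brownian
motion, w.r.t. `hW.natFiltration`: `E[sup_{s≤t}(J_s − J'_s)²] ≤ 4 E ∫₀ᵗ (H_s − H'_s)² ds`. [folklore] -/
theorem lintegral_iSup_itoIntegral_flatCoord_sub_sq_le [IsProbabilityMeasure P]
    (hW : IsFlatBrownian W P) (i : Edge d L × κ) {H H' J J' : ℝ≥0 → Ω → ℝ}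
    (hH : IsStronglyProgressive hW.natFiltration H) (hH' : IsStronglyProgressive hW.natFiltration H')
    (hJ : IsItoIntegral H (fun t ω => W t ω i) J hW.natFiltration P)
    (hJ' : IsItoIntegral H' (fun t ω => W t ω i) J' hW.natFiltration P) (t : ℝ≥0) :
    ∫⁻ ω, ⨆ s ∈ Set.Iic t, ENNReal.ofReal ((J s ω - J' s ω) ^ 2) ∂P ≤
      4 * ∫⁻ ω, (∫⁻ s in Set.Icc (0 : ℝ) t,
        ENNReal.ofReal ((H s.toNNReal ω - H' s.toNNReal ω) ^ 2)) ∂P :=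
  IsItoIntegral.lintegral_iSup_sub_sq_le (martingale_flatCoord hW i) (martingale_flatCoord_sq_sub hW i)
    (fun t => memLp_two_flatCoord hW t i) (continuous_flatCoord hW i) hH hH' hJ hJ' t

end Summit.QuantumFields.YangMills.Theorems.ColdStartUniversality

end
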